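import Summits.QuantumFields.YangMills.Theorems.BalabanLadderIRClauseISingleCell
import Summits.QuantumFields.YangMills.Theorems.BalabanLadderIROnsetReductionSC
import HarnessLib

/-!
# Crux `IR` (stmt-QuantumFields-19354), stub `stub_onsetUcSC`: the registered statement from a SINGLE-SHELL-CELL influence number for
# the working class (lane A's located target, end to end)

Helper module for item `stmt-QuantumFields-19354` (`--supports`; it closes nothing); lead prover of the line.  Route-independent.

`onsetMixingTypicalUKPcSC_of_singleCellWorkingClassSC` — for every SIMPLY CONNECTED compact simple `G` and lattice representation `r`:
admissible `(n, ε)` (`ε · shellCount n ≤ 3/4`) and, for every `δ > 0` and all large `β`, SOME mesh `b ≥ 1` and parameters `(ℓ, T, Rs, E)`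
such that on every mesh-`b` frame (1) the working class `diluteTyp ∩ Typ_lx^int` has any-exterior single-cell rarity `δ` (= the explicit
inequality `workingBudget ≤ δ`, `Theorems/BalabanLadderIRWorkingClassBudget`) and (2) its SINGLE-SHELL-CELL INFLUENCE on the centre cell
through every cell union `Y ∋ 0` of the window is `≤ ε / shellCount n` — THEN `OnsetFormatsUc.OnsetMixingTypicalUKPcSC` (the statement of
`stub_onsetUcSC`, owner R89).  Composition of the lead's `SingleCell.clauseI_of_singleShellCellInfluence` (telescoping over shell cells),
`typLocal_workingClass` (cell-locality of the class) and `SupplierSC.onsetMixingTypicalUKPcSC_of_workingClassSC`.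

THE LOCATED NUMBER (what (2) asks at the onset mesh `b(β, δ) → ∞`): re-setting the links of ONE cell at cell-distance `2n+1` from the
centre, everything else typical and fixed, moves the centre-cell law under the kernel of any rim-reaching resampled region by at most
`ε / shellCount n ≤ 3 / (4 · shellCount n ²)` (`≈ 2.4·10⁻⁷` for `n = 1`).  HONEST FRAMING: that decay at scales beyond the correlation
length is the crux's research content (weak-coupling mixing of 4-d simply-connected-`G` lattice Yang–Mills) and is NOT claimed; not a
gap, not Clay.  No `sorry`; axioms ⊆ {propext, Classical.choice, Quot.sound}.
-/

set_option autoImplicit false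

noncomputable section

open MeasureTheory
open Literature.MathematicalPhysics.QuantumFieldTheory Literature.MathematicalPhysics.QuantumLattice
open Literature.Probability.LatticeModels
open Summit.QuantumFields.YangMills.Cruxes.IR.Tempered (cellEdges windowCells regionEdges)
open Summit.QuantumFields.YangMills.Cruxes.IR.ShellTempered (windowCellsPlus)
open Summit.QuantumFields.YangMills.Cruxes.IR.FixedMesh (ClauseI)
open Summit.QuantumFields.YangMills.Cruxes.IR.OnsetFormats (shellCount)
open Summit.QuantumFields.YangMills.Cruxes.IR.OnsetFormatsUc (IsFrame OnsetMixingTypicalUKPcSC)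
open Summit.QuantumFields.YangMills.Theorems.IRTypLocalExcess (WorkingClass typLocal_workingClass)
open Summit.QuantumFields.YangMills.Cruxes.IR.AfPincerUc.Supplier (SupCellRarityAt)
open Summit.QuantumFields.YangMills.Cruxes.IR.AfPincerUc.SingleCell (clauseI_of_singleShellCellInfluence)
open Summit.QuantumFields.YangMills.Cruxes.IR.AfPincerUc.SupplierSC (onsetMixingTypicalUKPcSC_of_workingClassSC)
open Summit.QuantumFields.YangMills.Cruxes.IR.AfPincerUc.Calibration (windowCells_subset_windowCellsPlus)

namespace Summit.QuantumFields.YangMills.Cruxes.IR.AfPincerUc.SingleCell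

/-- The shell has `shellCount n` cells: `#(windowCellsPlus n \ windowCells n) = (4n+3)⁴ − (4n+1)⁴`. -/
theorem card_shell (n : ℕ) : (((windowCellsPlus n \ windowCells n).card : ℕ) : ℝ) = shellCount n := by
  rw [Finset.card_sdiff_of_subset (windowCells_subset_windowCellsPlus n)]
  have hP : (windowCellsPlus n).card = (4 * n + 3) ^ 4 := by
    simp only [Summit.QuantumFields.YangMills.Cruxes.IR.ShellTempered.windowCellsPlus, Fintype.card_piFinset, Int.card_Icc,
      Finset.prod_const, Finset.card_univ, Fintype.card_fin]
    congr 1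
    omega
  have hW : (windowCells n).card = (4 * n + 1) ^ 4 := by
    simp only [Summit.QuantumFields.YangMills.Cruxes.IR.Tempered.windowCells, Fintype.card_piFinset, Int.card_Icc,
      Finset.prod_const, Finset.card_univ, Fintype.card_fin]
    congr 1
    omega
  rw [hP, hW]
  rfl

/-- **`stub_onsetUcSC`'s statement from a single-shell-cell influence number for the working class (simply connected `G`).** -/
theorem onsetMixingTypicalUKPcSC_of_singleCellWorkingClassSC
    (h : ∀ (G : Type) [Group G] [TopologicalSpace G] [IsTopologicalGroup G] [CompactSpace G],
      IsCompactSimpleLieGroup G → SimplyConnectedSpace G →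
      letI : MeasurableSpace G := borel G; haveI : BorelSpace G := ⟨rfl⟩;
      ∀ r : LatticeRep G, ∃ (n : ℕ) (ε : ℝ), 1 ≤ n ∧ 0 ≤ ε ∧ ε * shellCount n ≤ 3 / 4 ∧
        ∀ δ : ℝ, 0 < δ → ∃ β₂ : ℝ, ∀ β : ℝ, β₂ ≤ β → ∃ b : ℕ, 1 ≤ b ∧
          ∃ (ℓ : ℕ) (T : ℝ) (Rs : Set ℕ) (E : ℕ → ℝ), ∀ w : Fin 4 → ℤ → ℤ, IsFrame b w →
            SupCellRarityAt r.ρ β w (WorkingClass r.ρ ℓ T Rs E w) δ ∧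
            ∀ Y : Finset (Fin 4 → ℤ), Y ⊆ windowCells n → (0 : Fin 4 → ℤ) ∈ Y →
              ∀ c ∈ windowCellsPlus n \ windowCells n, ∀ ζ ζ' : LGConfig 4 G,
                (∀ c' ∈ windowCellsPlus n, c' ∉ Y →
                  ζ ∈ WorkingClass r.ρ ℓ T Rs E w c' ∧ ζ' ∈ WorkingClass r.ρ ℓ T Rs E w c') →
                (∀ e ∉ cellEdges w c, ζ e = ζ' e) →
                ∀ f : LGConfig 4 G → ℝ, IsCylinder f (cellEdges w 0) → Measurable f → (∀ U, 0 ≤ f U ∧ f U ≤ 1) →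
                  |(∫ U, f U ∂(ymSpecification r.ρ β (regionEdges w Y) ζ)) -
                    ∫ U, f U ∂(ymSpecification r.ρ β (regionEdges w Y) ζ')| ≤ ε / shellCount n) :
    OnsetMixingTypicalUKPcSC := by
  refine onsetMixingTypicalUKPcSC_of_workingClassSC fun G _ _ _ _ hG hsc => ?_
  letI : MeasurableSpace G := borel G
  haveI : BorelSpace G := ⟨rfl⟩
  intro r
  haveI : T2Space G := T2Space.of_injective_continuous r.injective r.continuous
  haveI : SecondCountableTopology G :=
    (r.continuous.isClosedEmbedding r.injective).isEmbedding.secondCountableTopology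
  obtain ⟨n, ε, hn, hε, hM, hrest⟩ := h G hG hsc r
  refine ⟨n, ε, hn, hε, hM, fun δ hδ => ?_⟩
  obtain ⟨β₂, hβ⟩ := hrest δ hδ
  refine ⟨β₂, fun β hb => ?_⟩
  obtain ⟨b, hb1, ℓ, T, Rs, E, hw⟩ := hβ β hb
  refine ⟨b, hb1, ℓ, T, Rs, E, fun w hwf => ⟨?_, (hw w hwf).1⟩⟩
  -- clause (i) from the single-cell influence `ε / shellCount n`, times `#shell = shellCount n`
  have hS0 : 0 < shellCount n := by
    unfold Summit.QuantumFields.YangMills.Cruxes.IR.OnsetFormats.shellCount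
    have h7 : (4 * n + 1) ^ 4 < (4 * n + 3) ^ 4 := Nat.pow_lt_pow_left (by omega) (by norm_num)
    exact_mod_cast Nat.sub_pos_of_lt h7
  have hloc : ∀ c ∈ windowCellsPlus n, DependsOn (fun σ : LGConfig 4 G => σ ∈ WorkingClass r.ρ ℓ T Rs E w c) ↑(cellEdges w c) :=
    fun c _ => (typLocal_workingClass r.ρ r.continuous ℓ T Rs E w).2 c
  have key := clauseI_of_singleShellCellInfluence r.ρ r.continuous hb1 hwf hloc (η := ε / shellCount n) (hw w hwf).2
  rwa [card_shell, mul_div_cancel₀ _ hS0.ne'] at key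

end Summit.QuantumFields.YangMills.Cruxes.IR.AfPincerUc.SingleCell

end
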